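import Summits.KontsevichZagierPeriods.KontsevichZagierPeriods.Theses.FurushoPentagon
import Summits.KontsevichZagierPeriods.KontsevichZagierPeriods.Theorems.FurushoPentagonReducedPeriodRingDefs
import Summits.KontsevichZagierPeriods.KontsevichZagierPeriods.Theorems.FurushoPentagonReducedPeriodRingCubeMerge
import Summits.KontsevichZagierPeriods.KontsevichZagierPeriods.Theorems.FurushoPentagonSectorToKernelStokesSpanCalibration
import Summits.KontsevichZagierPeriods.KontsevichZagierPeriods.Theorems.FurushoPentagonSectorToKernelSemialgebraicOfAlgebraic
import Summits.KontsevichZagierPeriods.KontsevichZagierPeriods.Theorems.FurushoPentagonSectorToKernelAdmissibleOfTame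
import Summits.KontsevichZagierPeriods.KontsevichZagierPeriods.Theorems.FurushoPentagonSectorToKernelRealStokesForm
import Literature.NumberTheory.Transcendental.KZCubicalCalculus
import Literature.NumberTheory.Transcendental.KZProductIdeal
import Literature.NumberTheory.Transcendental.KZRulesAssociator
import Literature.NumberTheory.Transcendental.KZKernelConjectureForms
import Literature.NumberTheory.Transcendental.AyoubPeriodSeries

/-!
# `SectorToKernel`, line `effective-cube-surjection`: the crux from its two leaves

Crux `FurushoPentagon.SectorToKernel` (stmt-KontsevichZagierPeriods-10813) =
`StuffleInKZ → HoffmanRelationInKZ → ∀ c, KZ.eval c = 0 → c ∈ KZ.relations`, whose conclusion is the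
kernel form of Kontsevich–Zagier's Conjecture 1 (`KZKernelConjecture`; `Theorems/SectorToKernel/Negative/
Anatomy.lean`). Line `effective-cube-surjection` compiles the KZ calculus into Ayoub's effective cube
presentation and imports J. Ayoub's effective cube conjecture (Ann. of Math. 181 (2015), Conj. 1.1 at
`k = ℚ`) as its single conjecture-grade leaf. Of its six registered stubs four are LANDED theorems
(`stub_admissibleOfTame` S2, `stub_realStokesForm` S3, `stub_semialgebraicOfAlgebraic` S4,
`stub_stokesSpanCalibration` S5, imported above) and two remain: the RESOLUTION stub S1
`stub_cubeResolution` (theorem-grade, Hironaka strength; it follows verbatim from the existing item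
stmt-KontsevichZagierPeriods-3574 `LiftingCriteria.CubeNashNormalForm`) and the LEAF S6
`stub_ayoubEffectiveCubeKernel` (Ayoub 2015 Conj. 1.1, open).

This file lands the line's COMPOSITION as sorry-free conditional theorems, the two open stubs entering
as explicit hypotheses (written out, so that no conjecture is asserted):

* `kzKernel_of_cubeResolution_of_ayoubKernel : S1 → S6 → ∀ c, KZ.eval c = 0 → c ∈ KZ.relations`;
* `sectorToKernel_of_cubeResolution_of_ayoubKernel : S1 → S6 → SectorToKernel` (registered);
* `kontsevichZagierPeriods_of_cubeResolution_of_ayoubKernel : S1 → S6 → KontsevichZagierPeriods` —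
  **Ayoub's effective cube conjecture together with the cubical resolution of the calculus implies
  Kontsevich–Zagier's Conjecture 1** for the calculus of `KZCalculus.lean` (one direction of Ayoub's
  remark that Conj. 1.1 is "a reformulation" of the period conjecture, [Ayoub 2015, §1.1; André,
  Colloquium De Giorgi 2013, §2.4], made kernel-checkable).

Composition: `c ∈ ker eval` ⇒ `c ∼ a ∈ cubicalSpan` (S1) ⇒ `a ∼ [r]` one tame cube class
(`ReducedPeriodRing.stub_cubeMerge`, landed) ⇒ `[r] ∼ [s]` Ayoub-admissible (S2) ⇒ `∫_{[0,1]ⁿ} s = 0`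
(soundness `KZ.relations_le_ker_eval_holds`) ⇒ `s ∘ pr = Σⱼ Stokesⱼ(Hⱼ)` on `[0,1]ⁿ⁺ᵈ` (S3 fed with S6)
with `Hⱼ` analytic and `ℚ`-semialgebraic (S4) ⇒ the padded class `[s]·[[0,1]ᵈ, 1] ∼ [s]` is a relation
(S5). The crux hypotheses `StuffleInKZ`, `HoffmanRelationInKZ` are idle (Anatomy: they are outputs of
the conclusion).

## References

* J. Ayoub, *Une version relative de la conjecture des périodes de Kontsevich–Zagier*, Ann. of Math.
  181 (2015), Conj. 1.1. [Ayoub2015]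
* J. Ayoub, *Periods and the conjectures of Grothendieck and Kontsevich–Zagier*, EMS Newsl. 91 (2014),
  Def. 9–10, Rem. 12–13. [Ayoub2014]
* M. Kontsevich, D. Zagier, *Periods* (2001), §1.2, §4.1. [KontsevichZagier2001]
-/

noncomputable section

namespace Summit.KontsevichZagierPeriods.FurushoPentagon.SectorToKernel

open Set MeasureTheory
open Literature.NumberTheory.Transcendental
open Literature.NumberTheory.Transcendental.KZ hiding cubicalSpan
open Summit.KontsevichZagierPeriods.KontsevichZagierPeriods.Theses.FurushoPentagon
open Summit.KontsevichZagierPeriods.FurushoPentagon.ReducedPeriodRing (unitCube cubicalGens cubicalSpan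
  stub_cubeMerge)

/-! ## Glue -/

/-- `unitCube n` is, by definition, `KZ.cube n`. [folklore] -/
theorem leaves_unitCube_eq_cube (n : ℕ) : unitCube n = KZ.cube n := rfl

/-- **Cube normal form**: if every representation is, modulo the KZ relations, a `ℤ`-combination of
tame cube classes (S1), then so is every formal combination. [Ayoub 2014, Rem. 12] -/
theorem leaves_cubeNormalForm
    (h1 : ∀ (N : ℕ) (u : IntegralRep N), ∃ c : FormalRep, c ∈ cubicalSpan ∧ of u - c ∈ relations)
    (c : FormalRep) : ∃ a ∈ cubicalSpan, c - a ∈ relations := by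
  induction c using FreeAbelianGroup.induction_on with
  | zero => exact ⟨0, cubicalSpan.zero_mem, by simp⟩
  | of x =>
    obtain ⟨n, u⟩ := x
    obtain ⟨a, ha, hua⟩ := h1 n u
    exact ⟨a, ha, hua⟩
  | neg x ih =>
    obtain ⟨a, ha, hxa⟩ := ih
    refine ⟨-a, cubicalSpan.neg_mem ha, ?_⟩
    have : -FreeAbelianGroup.of x - -a = -(FreeAbelianGroup.of x - a) := by abel
    rw [this]
    exact relations.neg_mem hxa
  | add x y hx hy =>
    obtain ⟨a, ha, hxa⟩ := hx
    obtain ⟨b, hb, hyb⟩ := hy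
    refine ⟨a + b, cubicalSpan.add_mem ha hb, ?_⟩
    have : x + y - (a + b) = (x - a) + (y - b) := by abel
    rw [this]
    exact relations.add_mem hxa hyb

/-- The constant cube representation `[[0,1]ᵈ, 1]` (analytic, `ℚ`-semialgebraic). [Ayoub 2014, Def. 10] -/
theorem leaves_exists_oneCube (d : ℕ) :
    ∃ u : IntegralRep d, u.domain = KZ.cube d ∧ u.integrand = fun _ => 1 := by
  have h1 : IsSemialgebraicFunOn ℚ (KZ.cube d) (fun _ : Fin d → ℝ => (1 : ℝ)) := by
    simpa using isSemialgebraicFunOn_aeval (R := ℝ) KZ.isSemialgebraic_cube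
      (1 : MvPolynomial (Fin d) ℚ)
  exact ⟨IntegralRep.tameCube (fun _ => (1 : ℝ)) analyticOnNhd_const h1, rfl, rfl⟩

/-- **`[[0,1]ᵈ, 1] ∼ [pt, 1]`** by `d` Newton–Leibniz moves along the last coordinate of the cube with
the primitive `F (x, t) = t`. [Kontsevich–Zagier 2001, §1.2 rule (3)] -/
theorem leaves_oneCube_sub_unit : ∀ (d : ℕ) (u : IntegralRep d), u.domain = KZ.cube d →
    u.integrand = (fun _ => 1) → of u - of IntegralRep.unit ∈ relations := by
  intro d
  induction d with
  | zero =>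
    intro u hd hi
    have hu : u = IntegralRep.unit :=
      IntegralRep.ext' (by rw [hd, IntegralRep.unit_domain, KZ.cube_zero])
        (by rw [hi, IntegralRep.unit_integrand])
    rw [hu, sub_self]
    exact relations.zero_mem
  | succ d ih =>
    intro u hd hi
    obtain ⟨u', hd', hi'⟩ := leaves_exists_oneCube d
    have hua : AnalyticOnNhd ℝ u.integrand (KZ.cube (d + 1)) := by
      rw [hi]; exact analyticOnNhd_const
    have hua' : AnalyticOnNhd ℝ u'.integrand (KZ.cube d) := by
      rw [hi']; exact analyticOnNhd_const
    have hFa : AnalyticOnNhd ℝ (fun z : Fin (d + 1) → ℝ => z (Fin.last d)) (KZ.cube (d + 1)) :=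
      (ContinuousLinearMap.proj (R := ℝ) (φ := fun _ : Fin (d + 1) => ℝ)
        (Fin.last d)).analyticOnNhd _
    have hmove : of u - of u' ∈ KZ.cubicalStokesGens := by
      refine KZ.mem_cubicalStokesGens (F := fun z => z (Fin.last d)) ⟨hd, hua⟩ ⟨hd', hua'⟩ hFa
        (isSemialgebraicFunOn_apply KZ.isSemialgebraic_cube (Fin.last d)) ?_ ?_
      · intro x _ t _
        rw [hi]
        simp only [Fin.snoc_last]
        exact hasDerivAt_id' t
      · intro x _
        simp [hi']
    have h1 : of u - of u' ∈ relations := KZ.cubicalStokesGens_subset_relations hmove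
    have h2 : of u' - of IntegralRep.unit ∈ relations := ih u' hd' hi'
    have : of u - of IntegralRep.unit = (of u - of u') + (of u' - of IntegralRep.unit) := by abel
    rw [this]
    exact relations.add_mem h1 h2

/-- **Padding by dummy variables**: `[s] ∼ [s] · [[0,1]ᵈ, 1]` (right unit modulo relations and the
two-sided ideal property of `KZ.relations` for the Fubini product). [Kontsevich–Zagier 2001, §4.1] -/
theorem leaves_of_sub_of_prod_oneCube {m d : ℕ} (s : IntegralRep m) (u : IntegralRep d)
    (hud : u.domain = KZ.cube d) (hui : u.integrand = fun _ => 1) :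
    of s - of (s.prod u) ∈ relations := by
  have h0 : of IntegralRep.unit - of u ∈ relations := by
    rw [← neg_sub]; exact relations.neg_mem (leaves_oneCube_sub_unit d u hud hui)
  have h1 : of s * of IntegralRep.unit - of s * of u ∈ relations :=
    mul_sub_mul_mem_relations (by rw [sub_self]; exact relations.zero_mem) h0
  have h2 : of s * of IntegralRep.unit - of s ∈ relations := mul_of_unit_sub_mem_relations (of s)
  have : of s - of (s.prod u) =
      (of s * of IntegralRep.unit - of s * of u) - (of s * of IntegralRep.unit - of s) := by
    rw [← of_mul_of]; abel
  rw [this]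
  exact relations.sub_mem h1 h2

/-- The product of two cube domains is the cube. [folklore] -/
theorem leaves_prodDomain_eq_cube {m d : ℕ} (s : IntegralRep m) (u : IntegralRep d)
    (hs : s.domain = KZ.cube m) (hu : u.domain = KZ.cube d) :
    IntegralRep.prodDomain s u = KZ.cube (m + d) := by
  ext z
  simp only [IntegralRep.mem_prodDomain, hs, hu, KZ.mem_cube]
  constructor
  · rintro ⟨h1, h2⟩ i
    induction i using Fin.addCases with
    | left i => simpa using h1 i
    | right j => simpa using h2 j
  · intro h
    exact ⟨fun i => h _, fun j => h _⟩

/-- The integrand of the padded representation is `s ∘ pr`. [folklore] -/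
theorem leaves_prod_oneCube_integrand {m d : ℕ} (s : IntegralRep m) (u : IntegralRep d)
    (hui : u.integrand = fun _ => 1) (z : Fin (m + d) → ℝ) :
    (s.prod u).integrand z = s.integrand (fun a => z (Fin.castAdd d a)) := by
  rw [IntegralRep.prod_integrand_eq, IntegralRep.prodFun_apply, hui, mul_one]

/-- The value of a cube representation is `∫_{[0,1]ⁿ}` of its integrand. [folklore] -/
theorem leaves_eval_of_eq_setIntegral_cube {m : ℕ} (s : IntegralRep m) (hs : s.domain = KZ.cube m) :
    eval (of s) = ∫ x in KZ.cube m, s.integrand x := by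
  rw [eval_of, IntegralRep.value, hs]

/-! ## The kernel form, the crux and Conjecture 1 from the two leaves -/

/-- **The kernel form of Conjecture 1 from the two leaves of line `effective-cube-surjection`**: the
cubical resolution S1 and Ayoub's effective cube conjecture S6 (both hypotheses written out) imply
`∀ c, KZ.eval c = 0 → c ∈ KZ.relations`, through the landed stubs S2–S5.
[Ayoub 2015, Conj. 1.1; Ayoub 2014, Rem. 12–13; Kontsevich–Zagier 2001, §1.2] -/
theorem kzKernel_of_cubeResolution_of_ayoubKernel
    (h1 : ∀ (N : ℕ) (u : IntegralRep N), ∃ c : FormalRep, c ∈ cubicalSpan ∧ of u - c ∈ relations)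
    (h6 : ∀ F ∈ AyoubRel.Oan (Rat.castHom ℂ), AyoubRel.intC F = 0 →
      F ∈ AyoubRel.kSpan (Rat.castHom ℂ)
        {x : AyoubRel.CSeries | ∃ G ∈ AyoubRel.Oan (Rat.castHom ℂ), ∃ i : ℕ, x = AyoubRel.relAC i G}) :
    ∀ c : FormalRep, eval c = 0 → c ∈ relations := by
  intro c hc
  -- (1) cube normal form and (2) merging: `c ∼ [r]`, `r` a tame cube class
  obtain ⟨a, ha, hca⟩ := leaves_cubeNormalForm h1 c
  obtain ⟨n, r, hrd, hra, har⟩ := stub_cubeMerge a ha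
  rw [leaves_unitCube_eq_cube] at hrd hra
  -- (3) `[r] ∼ [s]`, `s` Ayoub-admissible
  obtain ⟨s, hsd, hadm, hrs⟩ := stub_admissibleOfTame n r hrd hra
  have hcs : c - of s ∈ relations := by
    have := relations.add_mem (relations.add_mem hca har) hrs
    simpa using this
  -- (4) `∫_{[0,1]ⁿ} s = eval c = 0`
  have hs0 : ∫ x in KZ.cube n, s.integrand x = 0 := by
    have h1 : eval (c - of s) = 0 := relations_le_ker_eval_holds hcs
    rw [map_sub, hc, zero_sub, neg_eq_zero, leaves_eval_of_eq_setIntegral_cube s hsd] at h1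
    exact h1
  -- (5) real Stokes form of the padded integrand, from the leaf
  obtain ⟨d, k, i, H, hH, hid⟩ := stub_realStokesForm h6 n s hsd hadm hs0
  -- (6) the `Hⱼ` are `ℚ`-semialgebraic on the cube
  have hHs : ∀ j, AnalyticOnNhd ℝ (H j) (KZ.cube (n + d)) ∧
      IsSemialgebraicFunOn ℚ (KZ.cube (n + d)) (H j) :=
    fun j => ⟨(hH j).1, stub_semialgebraicOfAlgebraic (n + d) (H j) (hH j).1 (hH j).2⟩
  -- (7) pad `s` by `d` dummy variables and calibrate
  obtain ⟨u, hud, hui⟩ := leaves_exists_oneCube d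
  have htd : (s.prod u).domain = KZ.cube (n + d) := by
    rw [IntegralRep.prod_domain, leaves_prodDomain_eq_cube s u hsd hud]
  have hti : ∀ z ∈ KZ.cube (n + d), (s.prod u).integrand z =
      ∑ j, (fderiv ℝ (H j) z (Pi.single (i j) 1) - H j (Function.update z (i j) 1) +
        H j (Function.update z (i j) 0)) := by
    intro z hz
    rw [leaves_prod_oneCube_integrand s u hui z]
    exact hid z hz
  have ht : of (s.prod u) ∈ relations :=
    stub_stokesSpanCalibration (n + d) (s.prod u) htd k i H hHs hti
  have hst : of s - of (s.prod u) ∈ relations := leaves_of_sub_of_prod_oneCube s u hud hui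
  have : c = (c - of s) + (of s - of (s.prod u)) + of (s.prod u) := by abel
  rw [this]
  exact relations.add_mem (relations.add_mem hcs hst) ht

/-- **The crux from the two leaves** (registered stub of line `effective-cube-surjection`): S1 and S6
imply `SectorToKernel`; the crux hypotheses `StuffleInKZ`, `HoffmanRelationInKZ` are not used.
[Ayoub 2015, Conj. 1.1; Ayoub 2014, Rem. 12–13] -/
theorem sectorToKernel_of_cubeResolution_of_ayoubKernel :
    (∀ (N : ℕ) (u : IntegralRep N), ∃ c : FormalRep, c ∈ cubicalSpan ∧ of u - c ∈ relations) → (∀ F ∈ AyoubRel.Oan (Rat.castHom ℂ), AyoubRel.intC F = 0 → F ∈ AyoubRel.kSpan (Rat.castHom ℂ) {x : AyoubRel.CSeries | ∃ G ∈ AyoubRel.Oan (Rat.castHom ℂ), ∃ i : ℕ, x = AyoubRel.relAC i G}) → SectorToKernel :=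
  fun h1 h6 _ _ => kzKernel_of_cubeResolution_of_ayoubKernel h1 h6

/-- **Conjecture 1 from the two leaves**: the cubical resolution of the calculus (S1) together with
Ayoub's effective cube conjecture at `k = ℚ` (S6) implies the Kontsevich–Zagier period conjecture
`KontsevichZagierPeriods` for the calculus of `KZCalculus.lean` (through the tree theorem
`kzKernelConjecture_iff_isRational`: kernel form ⇔ two-representation form).
[Ayoub 2015, §1.1 (Conj. 1.1 as a reformulation of the period conjecture); Kontsevich–Zagier 2001, §1.2] -/
theorem kontsevichZagierPeriods_of_cubeResolution_of_ayoubKernel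
    (h1 : ∀ (N : ℕ) (u : IntegralRep N), ∃ c : FormalRep, c ∈ cubicalSpan ∧ of u - c ∈ relations)
    (h6 : ∀ F ∈ AyoubRel.Oan (Rat.castHom ℂ), AyoubRel.intC F = 0 →
      F ∈ AyoubRel.kSpan (Rat.castHom ℂ)
        {x : AyoubRel.CSeries | ∃ G ∈ AyoubRel.Oan (Rat.castHom ℂ), ∃ i : ℕ, x = AyoubRel.relAC i G}) :
    KontsevichZagierPeriods :=
  KontsevichZagierPeriods_iff.mpr
    (kzKernelConjecture_iff_isRational.mp (kzKernel_of_cubeResolution_of_ayoubKernel h1 h6))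

end Summit.KontsevichZagierPeriods.FurushoPentagon.SectorToKernel
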